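import Summits.KontsevichZagierPeriods.KontsevichZagierPeriods.Theses.PeriodConductors

/-!
# `Assembly` (stmt-KontsevichZagierPeriods-10400, route PeriodConductors) — proof

The route's assembly item `UnimodularKernel → RamifiedReduction → KontsevichZagierPeriods` is its
deciding theorem `closes` read as an implication. (lead c10 of crux 9129, banking)
-/

namespace Summit.KontsevichZagierPeriods.PeriodConductors

/-- **Assembly of route PeriodConductors** (stmt-KontsevichZagierPeriods-10400):
`UnimodularKernel → RamifiedReduction → KontsevichZagierPeriods` — the cruxes imply the
summit, by the route's deciding theorem `closes`. [Kontsevich–Zagier 2001, §1.2] [folklore] -/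
theorem assembly_proof :
    Summit.KontsevichZagierPeriods.KontsevichZagierPeriods.Theses.PeriodConductors.Assembly :=
  Summit.KontsevichZagierPeriods.KontsevichZagierPeriods.Theses.PeriodConductors.closes

end Summit.KontsevichZagierPeriods.PeriodConductors
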